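import Mathlib.AlgebraicTopology.SingularHomology.HomologyZero
import Mathlib.Algebra.Homology.ShortComplex.ModuleCat
import Summits.Ventures.HodgeRepro2.HostAPI.Carriers.AlgebraicTopology.SingularHomology.SingularChains
import Summits.Ventures.HodgeRepro2.HostAPI.Carriers.AlgebraicTopology.SingularHomology.SingularCochains
import Summits.Ventures.HodgeRepro2.HostAPI.Carriers.AlgebraicTopology.SingularHomology.CupProduct
import Summits.Ventures.HodgeRepro2.HostAPI.Util.ForallBinderLint
open HostAPI.Carriers

noncomputable section

open CategoryTheory Limits AlgebraicTopology Simplicial Opposite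

universe u v

namespace HostAPI.Carriers.AlgebraicTopology.SingularHomology

variable (R : Type v) [CommRing R] (M : Type v) [AddCommGroup M] [Module R M]
variable {X Y Z : Type u} [TopologicalSpace X] [TopologicalSpace Y] [TopologicalSpace Z]

section Chain

variable {R M} {p q n : ℕ}

lemma singularChainComplex.single_add (σ : SingularSimplex X n) (m m' : M) :
    singularChainComplex.single (R := R) σ (m + m') =
      singularChainComplex.single (R := R) σ m + singularChainComplex.single (R := R) σ m' := by
  rw [← singularChainComplex.singleₗ_apply, map_add, singularChainComplex.singleₗ_apply,
    singularChainComplex.singleₗ_apply]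

lemma singularChainComplex.single_smul (σ : SingularSimplex X n) (r : R) (m : M) :
    singularChainComplex.single (R := R) σ (r • m) =
      r • singularChainComplex.single (R := R) σ m := by
  rw [← singularChainComplex.singleₗ_apply, map_smul, singularChainComplex.singleₗ_apply]

variable (M) in

def capChain (h : p + q = n) (φ : SingularSimplex X p → R) :
    (singularChainComplex R M X).X n ⟶ (singularChainComplex R M X).X q :=
  Sigma.desc fun σ : SingularSimplex X n ↦
    φ (σ.frontFace (show p ≤ n by omega)) •
      (TopCat.toSSet.obj (TopCat.of X)).ιChainComplex (R := ModuleCat.of R (ULift.{u} M))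
        (σ.backFace (show q ≤ n by omega))

@[simp]
lemma capChain_single (h : p + q = n) (φ : SingularSimplex X p → R) (σ : SingularSimplex X n)
    (m : M) :
    capChain M h φ (singularChainComplex.single (R := R) σ m) =
      singularChainComplex.single (R := R) (σ.backFace (show q ≤ n by omega))
        (φ (σ.frontFace (show p ≤ n by omega)) • m) := by
  change (Sigma.ι (fun _ : SingularSimplex X n ↦ ModuleCat.of R (ULift.{u} M)) σ ≫
    capChain M h φ) (ULift.up m) = _
  rw [capChain, Sigma.ι_desc, singularChainComplex.single_smul]
  rfl

variable (M) in

def capChainₗ (h : p + q = n) : (SingularSimplex X p → R) →ₗ[R]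
    ((singularChainComplex R M X).X n ⟶ (singularChainComplex R M X).X q) where
  toFun φ := capChain M h φ
  map_add' φ ψ := by
    refine singularChainComplex.hom_ext fun σ m ↦ ?_
    change _ = capChain M h φ _ + capChain M h ψ _
    simp only [capChain_single, Pi.add_apply, add_smul, singularChainComplex.single_add]
  map_smul' r φ := by
    refine singularChainComplex.hom_ext fun σ m ↦ ?_
    change _ = r • capChain M h φ _
    simp only [capChain_single, Pi.smul_apply, smul_eq_mul, mul_smul,
      singularChainComplex.single_smul]

@[simp]
lemma capChainₗ_apply (h : p + q = n) (φ : SingularSimplex X p → R) :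
    capChainₗ M h φ = capChain M h φ := rfl

@[simp]
lemma capChain_zero (h : p + q = n) : capChain M h (0 : SingularSimplex X p → R) = 0 :=
  (capChainₗ M h).map_zero

lemma capChain_add (h : p + q = n) (φ ψ : SingularSimplex X p → R) :
    capChain M h (φ + ψ) = capChain M h φ + capChain M h ψ :=
  (capChainₗ M h).map_add φ ψ

lemma capChain_smul (h : p + q = n) (r : R) (φ : SingularSimplex X p → R) :
    capChain M h (r • φ) = r • capChain M h φ :=
  (capChainₗ M h).map_smul r φ

@[simp]
lemma capChain_cochainOne : capChain M (Nat.zero_add n) (cochainOne R X) = 𝟙 _ := by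
  refine singularChainComplex.hom_ext fun σ m ↦ ?_
  rw [capChain_single, cochainOne_apply, one_smul, SingularSimplex.backFace_self]
  rfl

lemma capChain_cochainCup {r m k : ℕ} (hpq : p + q = m) (hm : m + r = n) (hqr : q + r = k)
    (hk : p + k = n) (φ : SingularSimplex X p → R) (ψ : SingularSimplex X q → R) :
    capChain M hm (cochainCup hpq φ ψ) = capChain M hk φ ≫ capChain M hqr ψ := by
  refine singularChainComplex.hom_ext fun σ x ↦ ?_
  change _ = capChain M hqr ψ (capChain M hk φ _)
  simp only [capChain_single, cochainCup_apply, SingularSimplex.frontFace_frontFace,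
    SingularSimplex.backFace_backFace, mul_comm (φ _), mul_smul]
  rw [SingularSimplex.backFace_frontFace (k := k) _ _ (by omega) (by omega) (by omega)]

lemma capChain_map (f : C(X, Y)) (h : p + q = n) (φ : SingularSimplex Y p → R) :
    (singularChainComplex.map R M f).f n ≫ capChain M h φ =
      capChain M h ((singularCochainComplex.map R R f).f p φ) ≫
        (singularChainComplex.map R M f).f q := by
  refine singularChainComplex.hom_ext fun σ x ↦ ?_
  change capChain M h φ ((singularChainComplex.map R M f).f n _) =
    (singularChainComplex.map R M f).f q (capChain M h _ _)
  simp only [capChain_single, singularChainComplex.map_f_single,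
    SingularSimplex.frontFace_map, SingularSimplex.backFace_map,
    singularCochainComplex.map_apply]

theorem d_capChain (h : p + q = n) (φ : SingularSimplex X p → R) :
    capChain M (show p + (q + 1) = n + 1 by omega) φ ≫ (singularChainComplex R M X).d (q + 1) q =
      (-1 : R) ^ p • ((singularChainComplex R M X).d (n + 1) n ≫ capChain M h φ -
        capChain M (show (p + 1) + q = n + 1 by omega)
          ((singularCochainComplex R R X).d p (p + 1) φ)) := by
  subst h
  refine singularChainComplex.hom_ext fun σ m ↦ ?_
  simp only [ModuleCat.hom_comp, ModuleCat.hom_smul, ModuleCat.hom_sub, LinearMap.comp_apply,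
    LinearMap.smul_apply, LinearMap.sub_apply]
  simp only [capChain_single, singularChainComplex.d_single, map_sum, map_smul,
    singularCochainComplex.d_apply, Finset.sum_smul, smul_assoc, singularChainComplex.single_smul]
  rw [← singularChainComplex.singleₗ_apply (R := R) (σ := SingularSimplex.backFace _ σ), map_sum]
  simp only [map_smul, singularChainComplex.singleₗ_apply]

  rw [Finset.sum_fin_eq_sum_range (n := q + 2), Finset.sum_fin_eq_sum_range (n := p + q + 2),
    Finset.sum_fin_eq_sum_range (n := p + 2)]
  have hsplit : ∀ f : ℕ → ↑((singularChainComplex R M X).X q),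
      ∑ i ∈ Finset.range (p + q + 2), f i =
        ∑ i ∈ Finset.range (p + 1), f i + ∑ j ∈ Finset.range (q + 1), f (p + 1 + j) := fun f ↦ by
    rw [← Finset.sum_range_add, show p + 1 + (q + 1) = p + q + 2 by omega]
  simp only [Finset.smul_sum, smul_sub, smul_dite, smul_zero, smul_smul]
  have hpp : (-1 : R) ^ p * (-1) ^ p = 1 := by
    rw [← pow_add, ← two_mul, pow_mul, neg_one_sq, one_pow]
  rw [hsplit, Finset.sum_range_succ (n := p + 1), Finset.sum_range_succ' (n := q + 1),
    add_sub_add_comm, ← Finset.sum_sub_distrib,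
    Finset.sum_eq_zero (s := Finset.range (p + 1)) fun i hi ↦ ?_, zero_add, sub_eq_add_neg]
  · congr 1
    ·
      refine Finset.sum_congr rfl fun j hj ↦ ?_
      rw [Finset.mem_range] at hj
      rw [dif_pos (show j + 1 < q + 2 by omega), dif_pos (show p + 1 + j < p + q + 2 by omega),
        SingularSimplex.frontFace_face_of_lt (p := p) ⟨p + 1 + j, by omega⟩ (by omega)
          (show p < p + 1 + j by omega) σ,
        SingularSimplex.backFace_face_add j _ _ σ]
      congr 1
      rw [show p + 1 + j = p + (j + 1) by omega, pow_add _ p (j + 1), ← mul_assoc, ← mul_assoc,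
        hpp, one_mul, mul_comm]
    ·
      rw [dif_pos (show p + 1 < p + 2 by omega), dif_pos (show 0 < q + 2 by omega),
        SingularSimplex.face_frontFace_last, SingularSimplex.face_backFace_zero, ← neg_smul]
      congr 1
      rw [pow_succ, ← mul_assoc, ← mul_assoc, hpp, one_mul, pow_zero, mul_one, neg_mul, neg_neg,
        one_mul]
  ·
    rw [Finset.mem_range] at hi
    rw [dif_pos (show i < p + q + 2 by omega), dif_pos (show i < p + 2 by omega),
      SingularSimplex.frontFace_face_of_le (p := p) ⟨i, by omega⟩ (by omega)
        (show i ≤ p + 1 by omega) σ,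
      SingularSimplex.backFace_face_of_le (q := q) ⟨i, by omega⟩ (by omega)
        (show i + q ≤ p + q by omega) σ, sub_self]

end Chain

namespace singularChainComplex

variable {R M} {n : ℕ}

variable (R M X n) in

abbrev cycles : ModuleCat.{max u v} R := (singularChainComplex R M X).cycles n

variable (R M X n) in

abbrev iCycles : cycles R M X n ⟶ (singularChainComplex R M X).X n :=
  (singularChainComplex R M X).iCycles n

variable (R M X) in

abbrev toCycles (i j : ℕ) : (singularChainComplex R M X).X i ⟶ cycles R M X j :=
  (singularChainComplex R M X).toCycles i j

lemma cycles_ext {a b : cycles R M X n} (h : iCycles R M X n a = iCycles R M X n b) : a = b :=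
  (ModuleCat.mono_iff_injective (iCycles R M X n)).1 inferInstance h

@[simp]
lemma d_iCycles (j : ℕ) (a : cycles R M X n) :
    (singularChainComplex R M X).d n j (iCycles R M X n a) = 0 := by
  change (iCycles R M X n ≫ (singularChainComplex R M X).d n j) a = 0
  rw [HomologicalComplex.iCycles_d]
  rfl

@[simp]
lemma iCycles_toCycles (i j : ℕ) (c : (singularChainComplex R M X).X i) :
    iCycles R M X j (toCycles R M X i j c) = (singularChainComplex R M X).d i j c := by
  change (toCycles R M X i j ≫ iCycles R M X j) c = _
  rw [HomologicalComplex.toCycles_i]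

@[simp]
lemma homologyπ_toCycles (i j : ℕ) (c : (singularChainComplex R M X).X i) :
    (singularChainComplex R M X).homologyπ j (toCycles R M X i j c) = 0 := by
  change (toCycles R M X i j ≫ (singularChainComplex R M X).homologyπ j) c = 0
  rw [HomologicalComplex.toCycles_comp_homologyπ]
  rfl

variable (R M) in

abbrev cyclesMap (f : C(X, Y)) (n : ℕ) : cycles R M X n ⟶ cycles R M Y n :=
  HomologicalComplex.cyclesMap (singularChainComplex.map R M f) n

@[simp]
lemma iCycles_cyclesMap (f : C(X, Y)) (c : cycles R M X n) :
    iCycles R M Y n (cyclesMap R M f n c) = (map R M f).f n (iCycles R M X n c) := by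
  change (cyclesMap R M f n ≫ iCycles R M Y n) c = (iCycles R M X n ≫ (map R M f).f n) c
  rw [HomologicalComplex.cyclesMap_i]

lemma _root_.HostAPI.Carriers.AlgebraicTopology.SingularHomology.singularHomology.map_homologyπ (f : C(X, Y)) (c : cycles R M X n) :
    singularHomology.map R M f n ((singularChainComplex R M X).homologyπ n c) =
      (singularChainComplex R M Y).homologyπ n (cyclesMap R M f n c) := by
  change ((singularChainComplex R M X).homologyπ n ≫
    HomologicalComplex.homologyMap (map R M f) n) c =
    (cyclesMap R M f n ≫ (singularChainComplex R M Y).homologyπ n) c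
  rw [HomologicalComplex.homologyπ_naturality]

end singularChainComplex

@[elab_as_elim]
theorem singularHomology_induction_on {n : ℕ} {C : singularHomology R M X n → Prop}
    (x : singularHomology R M X n)
    (h : ∀ c : singularChainComplex.cycles R M X n,
      C ((singularChainComplex R M X).homologyπ n c)) : C x := by
  obtain ⟨y, rfl⟩ :=
    (ModuleCat.epi_iff_surjective ((singularChainComplex R M X).homologyπ n)).1 inferInstance x
  exact h y

section Cycles

variable {R M} {p q n : ℕ}

open singularChainComplex singularCochainComplex

lemma iCycles_capChain_d (h : p + q = n) (a : cocycles R R X p) (j : ℕ) :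
    iCycles R M X n ≫ capChain M h (iCocycles R R X p a) ≫ (singularChainComplex R M X).d q j =
      0 := by
  by_cases hj : j + 1 = q
  · subst hj
    obtain ⟨n, rfl⟩ : ∃ n', n = n' + 1 := ⟨p + j, by omega⟩
    have h0 : capChain M (show (p + 1) + j = n + 1 by omega)
        ((singularCochainComplex R R X).d p (p + 1) (iCocycles R R X p a)) = 0 := by
      rw [d_iCocycles (p + 1) a]
      exact capChain_zero _
    rw [d_capChain (M := M) (show p + j = n by omega), h0, sub_zero, Linear.comp_smul,
      HomologicalComplex.iCycles_d_assoc, zero_comp, smul_zero]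
  · rw [(singularChainComplex R M X).shape q j (by change j + 1 ≠ q at hj ⊢; exact hj), comp_zero,
      comp_zero]

variable (M) in

def capCycles (h : p + q = n) (a : cocycles R R X p) : cycles R M X n ⟶ cycles R M X q :=
  (singularChainComplex R M X).liftCycles (iCycles R M X n ≫ capChain M h (iCocycles R R X p a))
    ((ComplexShape.down ℕ).next q) rfl (by
      rw [Category.assoc]
      exact iCycles_capChain_d h a _)

@[simp]
lemma iCycles_capCycles (h : p + q = n) (a : cocycles R R X p) (c : cycles R M X n) :
    iCycles R M X q (capCycles M h a c) =
      capChain M h (iCocycles R R X p a) (iCycles R M X n c) := by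
  change (capCycles M h a ≫ iCycles R M X q) c = _
  rw [capCycles, HomologicalComplex.liftCycles_i]
  rfl

lemma capCycles_add (h : p + q = n) (a b : cocycles R R X p) :
    capCycles M h (a + b) = capCycles M h a + capCycles M h b := by
  ext c
  refine cycles_ext ?_
  change _ = iCycles R M X q (capCycles M h a c + capCycles M h b c)
  simp only [iCycles_capCycles, map_add]
  exact congrFun (congrArg (fun f ↦ ⇑(ModuleCat.Hom.hom f))
    (capChain_add (M := M) h (iCocycles R R X p a) (iCocycles R R X p b))) _

lemma capCycles_smul (h : p + q = n) (r : R) (a : cocycles R R X p) :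
    capCycles M h (r • a) = r • capCycles M h a := by
  ext c
  refine cycles_ext ?_
  change _ = iCycles R M X q (r • capCycles M h a c)
  simp only [iCycles_capCycles, map_smul]
  exact congrFun (congrArg (fun f ↦ ⇑(ModuleCat.Hom.hom f))
    (capChain_smul (M := M) h r (iCocycles R R X p a))) _

lemma homologyπ_capCycles_toCycles (h : p + q = n) (a : cocycles R R X p) (i : ℕ)
    (b : (singularChainComplex R M X).X i) :
    (singularChainComplex R M X).homologyπ q (capCycles M h a (toCycles R M X i n b)) = 0 := by
  by_cases hi : i = n + 1
  · subst hi
    have e : capCycles M h a (toCycles R M X (n + 1) n b) =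
        (-1 : R) ^ p • toCycles R M X (q + 1) q
          (capChain M (show p + (q + 1) = n + 1 by omega) (iCocycles R R X p a) b) := by
      refine cycles_ext ?_
      rw [iCycles_capCycles, iCycles_toCycles, map_smul, iCycles_toCycles]
      change _ = (-1 : R) ^ p • (capChain M _ (iCocycles R R X p a) ≫
        (singularChainComplex R M X).d (q + 1) q) b
      have h0 : capChain M (show (p + 1) + q = n + 1 by omega)
          ((singularCochainComplex R R X).d p (p + 1) (iCocycles R R X p a)) = 0 := by
        rw [d_iCocycles (p + 1) a]
        exact capChain_zero _
      rw [d_capChain (M := M) h, h0, sub_zero]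
      change _ = (-1 : R) ^ p • ((-1 : R) ^ p •
        capChain M h (iCocycles R R X p a) ((singularChainComplex R M X).d (n + 1) n b))
      rw [← mul_smul, ← mul_pow, neg_one_mul, neg_neg, one_pow, one_smul]
    rw [e, map_smul, homologyπ_toCycles, smul_zero]
  · have e : toCycles R M X i n b = 0 := cycles_ext (by
      rw [iCycles_toCycles, (singularChainComplex R M X).shape i n
        (by change n + 1 ≠ i; omega), map_zero]
      rfl)
    rw [e, map_zero, map_zero]

def capProductAux (h : p + q = n) (a : cocycles R R X p) :
    singularHomology R M X n ⟶ singularHomology R M X q :=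
  Cofork.IsColimit.desc
    ((singularChainComplex R M X).homologyIsCokernel ((ComplexShape.down ℕ).prev n) n rfl)
    (capCycles M h a ≫ (singularChainComplex R M X).homologyπ q) (by
      rw [zero_comp]
      ext b
      exact homologyπ_capCycles_toCycles h a _ b)

@[simp]
lemma capProductAux_homologyπ (h : p + q = n) (a : cocycles R R X p) (c : cycles R M X n) :
    capProductAux (M := M) h a ((singularChainComplex R M X).homologyπ n c) =
      (singularChainComplex R M X).homologyπ q (capCycles M h a c) := by
  have e := Cofork.IsColimit.π_desc'
    ((singularChainComplex R M X).homologyIsCokernel ((ComplexShape.down ℕ).prev n) n rfl)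
    (capCycles M h a ≫ (singularChainComplex R M X).homologyπ q)
  exact congr($(e (by
      rw [zero_comp]
      ext b
      exact homologyπ_capCycles_toCycles h a _ b)) c)

def capProductCocycles (h : p + q = n) :
    cocycles R R X p →ₗ[R] (singularHomology R M X n →ₗ[R] singularHomology R M X q) where
  toFun a := (capProductAux (M := M) h a).hom
  map_add' a a' := by
    ext x
    induction x using singularHomology_induction_on with
    | h c =>
      simp only [LinearMap.add_apply]
      change capProductAux h (a + a') _ = capProductAux h a _ + capProductAux h a' _
      simp only [capProductAux_homologyπ, capCycles_add]
      exact ((singularChainComplex R M X).homologyπ q).hom.map_add _ _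
  map_smul' r a := by
    ext x
    induction x using singularHomology_induction_on with
    | h c =>
      simp only [LinearMap.smul_apply, RingHom.id_apply]
      change capProductAux h (r • a) _ = r • capProductAux h a _
      simp only [capProductAux_homologyπ, capCycles_smul]
      exact ((singularChainComplex R M X).homologyπ q).hom.map_smul r _

@[simp]
lemma capProductCocycles_apply_homologyπ (h : p + q = n) (a : cocycles R R X p)
    (c : cycles R M X n) :
    capProductCocycles h a ((singularChainComplex R M X).homologyπ n c) =
      (singularChainComplex R M X).homologyπ q (capCycles M h a c) :=
  capProductAux_homologyπ h a c

lemma capProductCocycles_toCocycles (h : p + q = n) (i : ℕ)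
    (ψ : (singularCochainComplex R R X).X i) :
    capProductCocycles (M := M) h (toCocycles R R X i p ψ) = 0 := by
  ext x
  induction x using singularHomology_induction_on with
  | h c =>
  rw [capProductCocycles_apply_homologyπ, LinearMap.zero_apply]
  by_cases hi : i + 1 = p
  · subst hi
    obtain ⟨n, rfl⟩ : ∃ n', n = n' + 1 := ⟨i + q, by omega⟩
    have e : capCycles M h (toCocycles R R X i (i + 1) ψ) c =
        -(-1 : R) ^ i • toCycles R M X (q + 1) q
          (capChain M (show i + (q + 1) = n + 1 by omega) ψ (iCycles R M X (n + 1) c)) := by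
      refine cycles_ext ?_
      rw [iCycles_capCycles, map_smul, iCycles_toCycles]
      change capChain M h (iCocycles R R X (i + 1) (toCocycles R R X i (i + 1) ψ)) _ =
        -(-1 : R) ^ i • (capChain M _ ψ ≫ (singularChainComplex R M X).d (q + 1) q) _
      rw [d_capChain (M := M) (show i + q = n by omega), iCocycles_toCocycles]
      change _ = -(-1 : R) ^ i • ((-1 : R) ^ i • (capChain M (show i + q = n by omega) ψ
        ((singularChainComplex R M X).d (n + 1) n (iCycles R M X (n + 1) c)) -
          capChain M h ((singularCochainComplex R R X).d i (i + 1) ψ) (iCycles R M X (n + 1) c)))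
      rw [d_iCycles, map_zero, zero_sub, smul_neg, neg_smul_neg, ← mul_smul, ← mul_pow,
        neg_one_mul, neg_neg, one_pow, one_smul]
    rw [e, map_smul, homologyπ_toCycles, smul_zero]
  · have e : toCocycles R R X i p ψ = 0 := cocycles_ext (by
      rw [iCocycles_toCocycles, (singularCochainComplex R R X).shape i p hi, map_zero]
      rfl)
    rw [e, ← zero_smul R (0 : cocycles R R X p), capCycles_smul, zero_smul]
    exact ((singularChainComplex R M X).homologyπ q).hom.map_zero

def capProductHom (h : p + q = n) :
    singularCohomology R R X p ⟶
      ModuleCat.of R (singularHomology R M X n →ₗ[R] singularHomology R M X q) :=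
  Cofork.IsColimit.desc
    ((singularCochainComplex R R X).homologyIsCokernel ((ComplexShape.up ℕ).prev p) p rfl)
    (ModuleCat.ofHom (capProductCocycles h)) (by
      rw [zero_comp]
      ext ψ : 2
      exact capProductCocycles_toCocycles h _ ψ)

@[simp]
lemma capProductHom_π (h : p + q = n) (a : cocycles R R X p) :
    capProductHom (M := M) h (singularCohomology.π R R X p a) = capProductCocycles h a := by
  have e := Cofork.IsColimit.π_desc'
    ((singularCochainComplex R R X).homologyIsCokernel ((ComplexShape.up ℕ).prev p) p rfl)
    (ModuleCat.ofHom (capProductCocycles (M := M) (X := X) h))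
  exact congr($(e (by
      rw [zero_comp]
      ext ψ : 2
      exact capProductCocycles_toCocycles h _ ψ)) a)

def capProduct (h : p + q = n) :
    singularCohomology R R X p →ₗ[R] singularHomology R M X n →ₗ[R] singularHomology R M X q :=
  (capProductHom h).hom

@[simp]
lemma capProduct_π_homologyπ (h : p + q = n) (a : cocycles R R X p) (c : cycles R M X n) :
    capProduct h (singularCohomology.π R R X p a) ((singularChainComplex R M X).homologyπ n c) =
      (singularChainComplex R M X).homologyπ q (capCycles M h a c) := by
  change capProductHom h (singularCohomology.π R R X p a)
    ((singularChainComplex R M X).homologyπ n c) = _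
  rw [capProductHom_π, capProductCocycles_apply_homologyπ]

end Cycles

section Properties

variable {R M} {p q n : ℕ}

open singularChainComplex singularCochainComplex

theorem one_capProduct (c : singularHomology R M X n) :
    capProduct (Nat.zero_add n) (singularCohomology.one R X) c = c := by
  induction c using singularHomology_induction_on with
  | h c =>
    rw [singularCohomology.one, capProduct_π_homologyπ]
    congr 1
    refine cycles_ext ?_
    rw [iCycles_capCycles, iCocycles_mk, capChain_cochainOne]
    rfl

theorem cupProduct_capProduct {r m k : ℕ} (hpq : p + q = m) (hm : m + r = n) (hqr : q + r = k)
    (hk : p + k = n) (a : singularCohomology R R X p) (b : singularCohomology R R X q)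
    (c : singularHomology R M X n) :
    capProduct hm (cupProduct hpq a b) c = capProduct hqr b (capProduct hk a c) := by
  induction a using singularCohomology_induction_on with
  | h a =>
  induction b using singularCohomology_induction_on with
  | h b =>
  induction c using singularHomology_induction_on with
  | h c =>
    simp only [cupProduct_π_π, capProduct_π_homologyπ]
    congr 1
    refine cycles_ext ?_
    simp only [iCycles_capCycles]
    change capChain M hm (iCocycles R R X m (cocyclesCup hpq a b)) _ = _
    rw [iCocycles_cocyclesCup]
    change capChain M hm (cochainCup hpq _ _) _ = _
    rw [capChain_cochainCup (M := M) hpq hm hqr hk]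
    rfl

theorem capProduct_map (f : C(X, Y)) (h : p + q = n) (a : singularCohomology R R Y p)
    (c : singularHomology R M X n) :
    singularHomology.map R M f q (capProduct h (singularCohomology.map R R f p a) c) =
      capProduct h a (singularHomology.map R M f n c) := by
  induction a using singularCohomology_induction_on with
  | h a =>
  induction c using singularHomology_induction_on with
  | h c =>
    rw [singularCohomology.map_π, capProduct_π_homologyπ, singularHomology.map_homologyπ,
      singularHomology.map_homologyπ, capProduct_π_homologyπ]
    congr 1
    refine cycles_ext ?_
    rw [iCycles_cyclesMap, iCycles_capCycles, iCycles_capCycles, iCycles_cyclesMap]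
    change _ = ((singularChainComplex.map R M f).f n ≫ capChain M h (iCocycles R R Y p a)) _
    rw [capChain_map, iCocycles_cocyclesMap]
    rfl

end Properties

section Kronecker

variable {R M} {p q n : ℕ}

open singularChainComplex singularCochainComplex

variable (M X) in

def singularChainComplex.augment :
    (singularChainComplex R M X).X 0 ⟶ ModuleCat.of R (ULift.{u} M) :=
  Sigma.desc fun _ : SingularSimplex X 0 ↦ 𝟙 _

@[simp]
lemma singularChainComplex.augment_single (x : SingularSimplex X 0) (m : M) :
    singularChainComplex.augment M X (single (R := R) x m) = ULift.up m := by
  change (Sigma.ι (fun _ : SingularSimplex X 0 ↦ ModuleCat.of R (ULift.{u} M)) x ≫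
    singularChainComplex.augment M X) (ULift.up m) = _
  rw [singularChainComplex.augment, Sigma.ι_desc]
  rfl

lemma singularHomology.ε_homologyπ (z : cycles R M X 0) :
    singularHomology.ε R M X ((singularChainComplex R M X).homologyπ 0 z) =
      singularChainComplex.augment M X (iCycles R M X 0 z) := by
  set L : (singularChainComplex R M X).X 0 ⟶ cycles R M X 0 :=
    (singularChainComplex R M X).liftCycles (𝟙 _) 0 (by simp) (by simp) with hL
  have hz : z = L (iCycles R M X 0 z) := cycles_ext (by
    change _ = (L ≫ iCycles R M X 0) _
    rw [hL, HomologicalComplex.liftCycles_i]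
    rfl)
  have hε₁ : ∀ (x : SingularSimplex X 0) (m : M), singularHomology.ε R M X
      ((singularChainComplex R M X).homologyπ 0 (L (single (R := R) x m))) = ULift.up m := by
    intro x m
    have h1 : L (single (R := R) x m) = (singularChainComplex R M X).liftCycles
        ((TopCat.toSSet.obj (TopCat.of X)).ιChainComplex (R := ModuleCat.of R (ULift.{u} M)) x)
        0 (by simp) (by simp) (ULift.up m) :=
      cycles_ext (by
        change (L ≫ iCycles R M X 0) _ = (HomologicalComplex.liftCycles _ _ _ _ _ ≫ iCycles R M X 0) _
        rw [hL, HomologicalComplex.liftCycles_i, HomologicalComplex.liftCycles_i]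
        rfl)
    rw [h1]
    exact congr($(SSet.liftCycles_ιChainComplex_homologyπ_homology₀ε
      (TopCat.toSSet.obj (TopCat.of X)) (ModuleCat.of R (ULift.{u} M)) x) (ULift.up m))
  have hε : L ≫ (singularChainComplex R M X).homologyπ 0 ≫ singularHomology.ε R M X =
      singularChainComplex.augment M X := by
    refine singularChainComplex.hom_ext fun x m ↦ ?_
    rw [singularChainComplex.augment_single]
    exact hε₁ x m
  conv_lhs => rw [hz]
  exact congr($hε (iCycles R M X 0 z))

lemma singularChainComplex.map_f_augment (f : C(X, Y)) :
    (singularChainComplex.map R M f).f 0 ≫ singularChainComplex.augment M Y =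
      singularChainComplex.augment M X := by
  refine singularChainComplex.hom_ext fun x m ↦ ?_
  change singularChainComplex.augment M Y ((singularChainComplex.map R M f).f 0 _) = _
  rw [map_f_single, augment_single, augment_single]

lemma singularHomology.map_ε (f : C(X, Y)) :
    singularHomology.map R M f 0 ≫ singularHomology.ε R M Y = singularHomology.ε R M X := by
  refine ModuleCat.hom_ext (LinearMap.ext fun c ↦ ?_)
  induction c using singularHomology_induction_on with
  | h c =>
    change singularHomology.ε R M Y (singularHomology.map R M f 0 _) = _
    rw [singularHomology.map_homologyπ, singularHomology.ε_homologyπ,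
      singularHomology.ε_homologyπ, iCycles_cyclesMap]
    exact congr($(singularChainComplex.map_f_augment (M := M) f) (iCycles R M X 0 c))

variable (R M X) in

def kroneckerPairing (n : ℕ) :
    singularCohomology R R X n →ₗ[R] singularHomology R M X n →ₗ[R] M :=
  (capProduct (M := M) (Nat.add_zero n)).compr₂
    (ULift.moduleEquiv.toLinearMap ∘ₗ (singularHomology.ε R M X).hom)

lemma kroneckerPairing_apply (a : singularCohomology R R X n) (c : singularHomology R M X n) :
    kroneckerPairing R M X n a c =
      (singularHomology.ε R M X (capProduct (Nat.add_zero n) a c)).down :=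
  rfl

theorem kroneckerPairing_π_single {ι : Type*} (s : Finset ι) (σ : ι → SingularSimplex X n)
    (m : ι → M) (a : cocycles R R X n) (z : cycles R M X n)
    (hz : iCycles R M X n z = ∑ i ∈ s, single (R := R) (σ i) (m i)) :
    kroneckerPairing R M X n (singularCohomology.π R R X n a)
      ((singularChainComplex R M X).homologyπ n z) =
        ∑ i ∈ s, iCocycles R R X n a (σ i) • m i := by
  rw [kroneckerPairing_apply, capProduct_π_homologyπ, singularHomology.ε_homologyπ,
    iCycles_capCycles, hz, map_sum, map_sum]
  change ULift.moduleEquiv (R := R) (∑ i ∈ s, _) = _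
  rw [map_sum]
  refine Finset.sum_congr rfl fun i _ ↦ ?_
  rw [capChain_single, singularChainComplex.augment_single, SingularSimplex.frontFace_self]
  rfl

theorem kroneckerPairing_cupProduct (h : p + q = n) (a : singularCohomology R R X p)
    (b : singularCohomology R R X q) (c : singularHomology R M X n) :
    kroneckerPairing R M X n (cupProduct h a b) c =
      kroneckerPairing R M X q b (capProduct h a c) := by
  rw [kroneckerPairing_apply, kroneckerPairing_apply,
    cupProduct_capProduct h (Nat.add_zero n) (Nat.add_zero q) h]

theorem kroneckerPairing_map (f : C(X, Y)) (a : singularCohomology R R Y n)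
    (c : singularHomology R M X n) :
    kroneckerPairing R M X n (singularCohomology.map R R f n a) c =
      kroneckerPairing R M Y n a (singularHomology.map R M f n c) := by
  rw [kroneckerPairing_apply, kroneckerPairing_apply, ← capProduct_map]
  change _ = ((singularHomology.map R M f 0 ≫ singularHomology.ε R M Y) _).down
  rw [singularHomology.map_ε]

end Kronecker

end HostAPI.Carriers.AlgebraicTopology.SingularHomology
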